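import Literature.Claims.NS.ClayTorusBridge
import Literature.Analysis.FluidPDE.TorusClassicalNSGalileanBoost
import Literature.Analysis.FluidPDE.TorusWeakStrongUniqueness
import Literature.Analysis.FluidPDE.NSHopfExistenceProofs
import Literature.Analysis.FluidPDE.ExtremeGrowthVorticityControl
import Literature.Analysis.FluidPDE.TorusClassicalH1Balance
import Literature.Analysis.FluidPDE.ExtremeGrowthVorticityControlProofs
import Literature.Analysis.FunctionSpaces.TorusAgmonExplicit
import Literature.Analysis.FunctionSpaces.TorusFluidGlueProofs
import Literature.Analysis.FunctionSpaces.TorusSobolevNormSmoothProofs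
import Literature.Analysis.FunctionSpaces.TorusFourierCalculus
import Mathlib.Analysis.Calculus.MeanValue
import HarnessLib

/-!
# C135 `Siche2026` — B. Siche, «Phase Decoherence and Regularity of the Three-Dimensional Navier–Stokes
# Equations», Zenodo, v1.5 (2026-04-29, record 19899171, doi:10.5281/zenodo.19899171; concept 19256897)
# [Siche2026] — typed skeleton (D-0090 NS-CLAIMS SWEEP)

UNREFEREED / DISPUTED CLAIM under adjudication — nothing in this file asserts a step. Cell `ns-claims`,
claim C135 (census DELTA-24 (b); NUMBERED RULINGS v1.31d (3)(b) 2026-08-27T04:18:19Z; tier T3 QUICK).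
Typist ns-claims-typist-3 g4; PREDICTED C135 04:22:57Z (CARD sha16 cce976ed15d57922, before any page was
opened). TEXT OF RECORD = v1.5 (chair's re-pin 04:29:20Z; v1.4 = record 19742152, 51 pp., was the census
identifier). Pages and display numbers below are v1.5 (PDF page = printed page; `sources/Siche2026/v1.5/`,
lit-1 g7 LOCATORS.md; v1.4 numbers in square brackets where useful: Thm 6.28 = [7.24], Thm 7.1 = [8.1],
Prop 7.2 = [8.5], Thm 7.3 = [8.8], Thm 6.4 = [7.3], Prop 8.1 = [9.1]).

## The claimed statement (verbatim, p. 1)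

«Theorem 1.2 (Global regularity). Conjecture 1.1 holds. More precisely: let ν > 0 and u₀ ∈ H¹(T³; R³)
with ∇ · u₀ = 0. Then any Leray–Hopf weak solution of (1) satisfies u ∈ C^∞(T³ × (0, ∞)). The associated
pressure, recovered from −∆p = ∂ᵢ∂ⱼ(uᵢuⱼ), satisfies p ∈ C^∞(T³ × (0, ∞)). In particular, the Leray–Hopf weak
solution is unique.» Setting §1.1 p. 1: (1) is the unforced system on T³ = (ℝ/2πℤ)³, ν > 0, f ≡ 0; «This is
Problem (B) of Fefferman [20]», footnote 1: «Fefferman's formulation uses period 1 (R³/Z³); our torus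
T³ = (R/2πZ)³ is related by the rescaling x ↦ 2πx, ν ↦ 4π²ν, which preserves the equation's structure.»

## Clay delta (CARD §3; reference `ClayVariants.lean`, `ClayTorusBridge.lean`)

Nearest Clay statement: (B) `ClayVariants.clayPeriodic.Regularity`. Δ1 domain: the flat torus — typed on the
tree's unit torus `UnitAddTorus (Fin 3)` by the paper's own footnote 1 (the claim is made for every `ν > 0`,
so the period rescaling is immaterial); Δ3 force `f ≡ 0` =; Δ4 data `H¹`, weakly divergence-free — WIDER than
(8); Δ5 solution class: EVERY Leray–Hopf weak solution is smooth for `t > 0` — STRONGER than (B)'s existence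
of one smooth solution; Δ7 horizon `(0, ∞)` =; pressure periodic automatically on the torus. No wrong-problem
axis: `clay_of_claimed : ClaimedTheorem → clayPeriodic.Regularity` is PROVED below (Hopf existence on 𝕋³,
weak–strong uniqueness `Torus.IsLerayHopfOn.ae_eq_of_isClassicalNSSolutionOn`, the maximal classical solution
with the enstrophy alternative `Torus.exists_maximal_classicalNS_anyMean`, all in the tree).

## The objects (§2, §4.1, §7.1) and how they are typed

Helical Fourier decomposition (4)–(5) p. 4 in the gauge (39) p. 16: for `k ∈ ℤ³ \ {0}`,
`ê₁(k̂) = ẑ × k̂/‖ẑ × k̂‖`, `ê₂ = k̂ × ê₁`, `h^σ_k = (ê₁ + iσ ê₂)/√2` (`σ = ±1`; so that `ik × h^σ_k = σ|k| h^σ_k`,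
(5)); the print leaves the frame undefined at `k ∥ ẑ` («the singular set {±ẑ} ∩ S_K contains at most two
lattice modes», p. 16) — typed convention there: `ê₁ := x̂`. Helical coordinate of a field `v : 𝕋³ → ℝ³` at
`(k, σ)`: `c^σ_k := ⟪h^σ_k, v̂(k)⟫_ℂ = a^σ_k e^{iθ^σ_k}` with `v̂(k) = mFourierCoeff (complexify ∘ v) k` (characters
`e^{2πik·x}` of the unit torus in place of `e^{ik·x}`). Shell `S_K = {k ∈ ℤ³ : |k|² = K}` (6) p. 4;
`N_K` = number of modes on `S_K` COUNTING BOTH HELICITY SECTORS (Definition 4.1 p. 7; = `2·#S_K`); mean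
amplitude `ā_K = N_K⁻¹ Σ_{k ∈ S_K, σ} a^σ_k` over the FULL shell; shifted shell magnetisation (52) p. 23 /
(20) p. 7 `m_K(x) = N_K⁻¹ Σ_{k∈S_K,σ} (a^σ_k/ā_K) e^{i(θ^σ_k + k·x)} = (N_K ā_K)⁻¹ Σ_{k,σ} c^σ_k e^{2πik·x}`; shell
coherence `χ_K(x) = N_K |m_K(x)|²` ((20) is `x = 0`). Junk values: an empty/silent shell (`N_K ā_K = 0`) has
`m_K = 0`, `χ_K = 0`. By the triangle inequality `|m_K(x)| ≤ 1`, `χ_K(x) ≤ N_K` always (print p. 7: «For fully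
coherent (aligned) phases, χ_K = N_K»).

The paper's §§4.2–6.7 argue inside a STOCHASTIC phase-oscillator picture («conditioned on the bath»,
`E[·]`, Von Mises / «paramagnetic-Gibbs hypothesis» (p. 3, Prop. 6.22 Step 1), K41 amplitude scaling
`a_k ∼ |k|^{-11/6}` «in the inertial range» (Prop. 4.2 p. 7), «f_K(R; B) = |m_K(t+τ)| given |m_K(t)| = R and
bath B» (Def. 6.1 p. 11) — not a function of `(R, B)` for a deterministic flow); footnote 2 p. 3: «the
deterministic-to-stochastic derivation from the Navier–Stokes dynamics is an open companion-paper
problem». What those sections ASSERT ABOUT THE FLOW is typed here at the print's own grain, read on the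
smooth solutions the proof manipulates (Prop. 6.29 (1) p. 22 «the solution … is smooth on [0, T*]»; §8.1
p. 26 «The argument above is carried out for Galerkin approximations»): classical solutions
`Torus.IsClassicalNSSolutionOn (Ico 0 T) ν 0 U P` of the unforced system on `[0, T) × 𝕋³`, any `T`, any mean.
Leray–Hopf weak solutions from `H¹` data enter only through `ClaimedTheorem` and `Step8_regularity` (§8).

## Steps (the paper's «six steps» table §1.5 p. 3 + the closure §7–§8), print locators v1.5

* `Step1_forcingDisjoint` — Thm 5.2 p. 8 «For any k ≠ l in ℤ³₀, F(k) ∩ F(l) = ∅», `F(k) = {(p,q) : k+p+q = 0}`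
  (Def. 5.1). PROVED in-skeleton (`step1_holds`): content-free arithmetic (footnote 5 p. 8 says so).
* `Step2_dephasing` — Prop. 5.9 p. 10 «For shells K ≥ K₀ (with K₀ = 5) … Full dephasing (∆φ ∼ 2π) occurs at
  τ_dec(K) = O(1/(U K^{1/2})), after which χ_K = O(1) regardless of the initial phase configuration»,
  `U ≤ √(2E₀)`; the ground for Remark 5.8 p. 10 («The √T_K bound (30) therefore holds for every smooth initial
  datum»).
* `Step3_contraction` — Lemma 6.7 p. 14 «For every smooth bath trajectory B(t), the on-shell magnetization
  satisfies f_K(R; B(·)) < R for all K ≥ 3 and all R > R*», `R* = C₀/((1−c)√N_K)`, `c < 1` universal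
  (Thm 6.4 (35) p. 12 `f_K(R; B) ≤ cR + C₀/√N_K`; §6.3 (3) p. 13; Prop. 6.29 (2) p. 22 «each [iteration] taking
  one eddy turnover τ_K»): typed as strict decrease of `|m_K|` above the noise floor across one (solution- and
  shell-dependent, positive) relaxation time.
* `Step4_globalDecoherence` — Thm 6.28 (51) p. 22 «sup_{K≥1} χ_K(t) = O(1) for all t > 0, where the bound
  depends on ‖u₀‖_{H¹} and ν but not on K» — DECL OF RECORD in the per-solution form `∃ C ∀ t ∀ K` (referee
  ref-3 g3 04:50:01Z (c)); the printed dependence `C = C(‖u₀‖_{H¹}, ν)` is `Step4_print` (`step4_of_print`).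
* `Step5_shiftedCoherence` — Thm 7.1 (52)–(53) p. 23 «Under the global decoherence conditions (Theorem 6.28) …
  there exists C > 0 (depending on ‖u₀‖_{H¹} and ν but not on K or x) such that χ_K(x) ≤ C for all K, all
  x ∈ T³, all t > 0» (per-solution form; print dependence alongside in `Step5_print`).
* `Step6_vorticityBound` — Prop. 7.2 (59) p. 24 «If χ_K(x) ≤ C_χ uniformly in K and x, then
  ‖ω(t)‖_∞ ≤ C(ν, E₀) · Ω(t)^{1/2}, where Ω(t) = ‖ω(t)‖²_{L²} is the enstrophy and C(ν, E₀) depends on C_χ, ν,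
  E₀, and universal constants» — typed AT FIELD GRAIN exactly as printed (no `K_max`): for every smooth
  divergence-free `v` on 𝕋³ with energy `≤ E₀`. Its proof p. 24 truncates the shell sum at «K_max ∼ Re^{3/4} …
  fixed by initial data» (`(Σ_{K=1}^{K_max} 1)^{1/2}`); the as-consumed instance «Step 2» p. 25 is `Step6_used`.
  (Typing note: (60)–(61) bound the VORTICITY shell sums by the VELOCITY-amplitude coherence; in helical
  coordinates `ω̂` carries the extra factor `σ|k|`, so `χ_K` of `u` and of `ω` differ by the sign `σ` across
  sectors — recorded, not repaired; the Step is the printed statement.)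
* `Step7_enstrophyClosure` — Thm 7.3 (62)–(64) p. 25: along a classical solution with energy `≤ E₀` and the
  pointwise bound of Step 6, `Ω(t) ≤ max(Ω(0), Ω*)` (last line of the proof p. 25), `Ω* = Ω*(ν, E₀, C)`.
* `Step8_regularity` — §8 «Proof of Theorem 1.2» Steps 3–5 p. 25–26 with §8.1 (Prop. 8.1, Galerkin passage,
  Aubin–Lions) and Step 4 p. 26 (weak–strong uniqueness, Temam Thm III.3.7): the a priori enstrophy bound along
  classical solutions ⇒ Theorem 1.2. TRUE in the classical theory (via (B) + local `H¹` strong solutions +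
  weak–strong uniqueness); typed, not proved.

COMPOSITION: `claim_of_steps : Step1 → … → Step8 → ClaimedTheorem` PROVED, the kernel chain being
`Step4 → Step5 → Step6 → Step7 → AprioriEnstrophy → Step8` (energy monotonicity of classical torus solutions
from the tree's `Torus.IsClassicalNSSolutionOn.energy_balance_holds`); `clay_of_steps : Step4 → Step5 → Step6 →
Step7 → clayPeriodic.Regularity` PROVED without Step 8 (maximal solution / enstrophy alternative). COMPOSITION
NOTE (recorded, not adjudicated): Steps 1–3 are the printed GROUNDS for Step 4 (Thm 6.28's induction §6.8
p. 22: Thm 5.2 + Thm 6.19 + Thm 6.4/Lemma 6.7 + Prop. 6.29); the implication Step1 ∧ Step2 ∧ Step3 ⇒ Step4 is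
NOT reproduced — Step 3 yields `χ_K ≤ O(1)` only after iterating the one-turnover contraction, whereas (51)
asserts it for ALL `t > 0` (bridged in print by Prop. 6.29 (2)–(3) p. 22, «cascade timing», K41 prose). The
typist does not invent the bridge; Steps 1–3 enter `claim_of_steps` as (unused) hypotheses.

Rev 2 (additive, §I): `Face_p14_dissipationRangeCount` — the mode-counting sentence inside Lemma 6.7's proof
(Step B p. 14: «dissipation-range shells … satisfy χ_K ≤ N_K = O(1)»), the print-earliest arithmetic face of the
same defect (referee REF INPUT #4); nothing renamed or removed.

KILL ROUTES pre-registered (CARD §4; refuter-7 g2 READ 04:49:14Z; ref-3 g3 PRE-READ 04:50:01Z): route 3 explicit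
countermodels — parallel-shear / single-helicity heat-flow solutions on sparse shells (`K = 4^a`, `N = 12`;
`K = 25^j`) have frozen helical phases (`|m_K|` constant in `t`: Steps 2–4) and bounded per-shell coherence
with `‖ω‖_∞/Ω^{1/2}` unbounded across octaves (Step 6); route 1 (averaged equation) is heuristic only here.

## References

* B. Siche, Zenodo record 19899171 (v1.5, 2026-04-29), doi:10.5281/zenodo.19899171. [Siche2026]
* C. L. Fefferman, CMI 2006, (B) with (8)–(11) p. 2. [FeffermanClay2006]
* J. C. Robinson, J. L. Rodrigo, W. Sadowski, CUP 2016, Thm 4.4 (Hopf), Thm 6.10 (weak–strong), §6.3/§8.1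
  (maximal solution, enstrophy alternative). [RobinsonRodrigoSadowskiCUP2016]
* F. Waleffe, Phys. Fluids A 4 (1992) 350–363 (helical decomposition, (7)). [cited as printed, ref. [37]]

WHAT THIS IS NOT: not a claim about NS regularity or blow-up; not a claim about any author beyond the
typed locator.
-/

noncomputable section

open Set MeasureTheory Filter
open scoped ContDiff ComplexConjugate RealInnerProductSpace

namespace Literature.Claims.NS.Siche2026

open Literature.Analysis Literature.Analysis.FluidPDE Literature.Analysis.FunctionSpaces
open Literature.Claims.NS.ClayVariants

/-! ## §A. Carriers -/

/-- `ℝ³` (velocity values). [cite: Siche2026, §1.1 (1) p. 1] -/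
abbrev E3 : Type := EuclideanSpace ℝ (Fin 3)

/-- `ℂ³` (Fourier / helical coefficients). [cite: Siche2026, §2.1 (4) p. 4] -/
abbrev C3 : Type := EuclideanSpace ℂ (Fin 3)

/-- The flat torus; the paper's `T³ = (ℝ/2πℤ)³` is read on the unit torus `ℝ³/ℤ³` by its footnote 1 p. 1
(«related by the rescaling x ↦ 2πx, ν ↦ 4π²ν, which preserves the equation's structure»; the claim is made
for every `ν > 0`). [cite: Siche2026, §1.1 p. 1 with footnote 1] -/
abbrev T3 : Type := UnitAddTorus (Fin 3)

/-- The integer lattice `ℤ³` of wave vectors. [cite: Siche2026, §2.1 (4) p. 4] -/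
abbrev Z3 : Type := Fin 3 → ℤ

/-! ## §B. Lattice shells, forcing sets (§2.2, §5.1) -/

/-- `|k|² ∈ ℤ` for `k ∈ ℤ³` — the shell index convention `|k|² = K`. [cite: Siche2026, §2.2 (6) p. 4] -/
def latticeNormSq (k : Z3) : ℤ := ∑ i, k i ^ 2

/-- The spectral shell `S_K = {k ∈ ℤ³ : |k|² = K}` as a finite set (every coordinate of such `k` lies in
`[-K, K]`). [cite: Siche2026, §2.2 (6) p. 4] -/
def shell (K : ℕ) : Finset Z3 :=
  (Fintype.piFinset fun _ : Fin 3 => Finset.Icc (-(K : ℤ)) K).filter fun k => latticeNormSq k = K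

/-- `N_K` = the number of modes on `S_K` «counting both helicity sectors» (Definition 4.1 p. 7), i.e.
`2 · #S_K` (`#S_K = r₃(K)` is the lattice-point count of §2.2; base case p. 13 uses `N₁ = 6, N₂ = 12` for
`#S_K`, Definition 4.1 doubles it — the doubled count is typed, as Definition 4.1 is the definition of `χ_K`).
[cite: Siche2026, Definition 4.1 p. 7; §2.2 p. 4] -/
def shellModes (K : ℕ) : ℕ := 2 * (shell K).card

/-- The forcing set `F(k) = {(p, q) ∈ ℤ³₀ × ℤ³₀ : k + p + q = 0}`. [cite: Siche2026, Definition 5.1 p. 8] -/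
def forcingSet (k : Z3) : Set (Z3 × Z3) :=
  {pq | pq.1 ≠ 0 ∧ pq.2 ≠ 0 ∧ k + pq.1 + pq.2 = 0}

/-! ## §C. The helical frame in the gauge (39) and the helical coordinates (§2.1) -/

/-- Cross product on `ℝ³` (components). [folklore] -/
def cross (a b : Fin 3 → ℝ) : Fin 3 → ℝ :=
  ![a 1 * b 2 - a 2 * b 1, a 2 * b 0 - a 0 * b 2, a 0 * b 1 - a 1 * b 0]

/-- Euclidean length on `ℝ³` (components). [folklore] -/
def len (a : Fin 3 → ℝ) : ℝ := Real.sqrt (∑ i, a i ^ 2)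

/-- The unit wave vector `k̂ = k/|k|` (junk `0` at `k = 0`). [cite: Siche2026, §2.1 (5) p. 4] -/
def unitVec (k : Z3) : Fin 3 → ℝ := fun i => (k i : ℝ) / len fun j => (k j : ℝ)

open Classical in
/-- `ê₁(k̂) := ẑ × k̂/‖ẑ × k̂‖` — the gauge (39) p. 16, with the convention `ê₁ := x̂` at the poles `k ∥ ẑ` where
the print leaves the frame undefined («the singular set {±ẑ} ∩ S_K contains at most two lattice modes»).
[cite: Siche2026, (39) p. 16] -/
def frame₁ (k : Z3) : Fin 3 → ℝ :=
  if cross ![0, 0, 1] (unitVec k) = 0 then ![1, 0, 0]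
    else fun i => cross ![0, 0, 1] (unitVec k) i / len (cross ![0, 0, 1] (unitVec k))

/-- `ê₂(k̂) := k̂ × ê₁(k̂)`. [cite: Siche2026, (39) p. 16] -/
def frame₂ (k : Z3) : Fin 3 → ℝ := cross (unitVec k) (frame₁ k)

/-- The helical basis vector `h^σ_k = (ê₁ + iσ ê₂)/√2 ∈ ℂ³` (`σ = true` ↔ `+`, `false` ↔ `−`), satisfying
`ik × h^σ_k = σ|k| h^σ_k` for the right-handed frame `(ê₁, ê₂, k̂)`. [cite: Siche2026, §2.1 (4)–(5) p. 4; (39) p. 16] -/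
def hel (k : Z3) (σ : Bool) : C3 :=
  WithLp.toLp 2 fun i =>
    ((frame₁ k i : ℂ) + Complex.I * (if σ then 1 else -1) * (frame₂ k i : ℂ)) / (Real.sqrt 2 : ℂ)

/-- The vector Fourier coefficient `v̂(k) ∈ ℂ³` of a field on the unit torus (characters `e^{2πik·x}`,
Mathlib `UnitAddTorus.mFourierCoeff` of the complexified field, as in the tree's `Torus.eSobolevNorm`).
[cite: Siche2026, §2.1 (4) p. 4] -/
def coeff (v : T3 → E3) (k : Z3) : C3 :=
  UnitAddTorus.mFourierCoeff (EuclideanSpace.complexify ∘ v) k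

/-- The helical coordinate `c^σ_k = ⟪h^σ_k, v̂(k)⟫ = a^σ_k e^{iθ^σ_k}` (amplitude `a^σ_k = |c^σ_k|`, phase
`θ^σ_k = arg c^σ_k`). [cite: Siche2026, §2.1 (4) p. 4] -/
def helCoeff (v : T3 → E3) (k : Z3) (σ : Bool) : ℂ :=
  inner ℂ (hel k σ) (coeff v k)

/-! ## §D. Shell magnetisation and coherence (Definition 4.1, (52)) -/

/-- The mean amplitude `ā_K = N_K⁻¹ Σ_{k ∈ S_K, σ} a^σ_k` over the FULL shell, both helicity sectors.
[cite: Siche2026, Definition 4.1 (20) p. 7] -/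
def meanAmp (v : T3 → E3) (K : ℕ) : ℝ :=
  (shellModes K : ℝ)⁻¹ * ∑ k ∈ shell K, (‖helCoeff v k true‖ + ‖helCoeff v k false‖)

/-- The shifted shell magnetisation `m_K(x) = N_K⁻¹ Σ_{k∈S_K,σ} (a^σ_k/ā_K) e^{i(θ^σ_k + k·x)}`
`= (N_K ā_K)⁻¹ Σ_{k,σ} c^σ_k e^{2πik·x}` ((52) p. 23; `x = 0` is Definition 4.1 (20) p. 7). Junk `0` on an empty
or silent shell. [cite: Siche2026, (52) p. 23; Definition 4.1 (20) p. 7] -/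
def magnetization (v : T3 → E3) (K : ℕ) (x : T3) : ℂ :=
  ((shellModes K : ℂ) * (meanAmp v K : ℂ))⁻¹ *
    ∑ k ∈ shell K, UnitAddTorus.mFourier k x * (helCoeff v k true + helCoeff v k false)

/-- The (shifted) shell coherence `χ_K(x) = N_K |m_K(x)|²` ((52) p. 23; Definition 4.1 p. 7 at `x = 0`:
«For fully incoherent (uniformly distributed) phases, χ_K = O(1). For fully coherent (aligned) phases,
χ_K = N_K.»). [cite: Siche2026, (52) p. 23; Definition 4.1 p. 7] -/
def coherence (v : T3 → E3) (K : ℕ) (x : T3) : ℝ :=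
  (shellModes K : ℝ) * ‖magnetization v K x‖ ^ 2

/-- The `H¹(𝕋³)` norm of a velocity field (the tree's spectral `Torus.sobolevNorm 1` of the complexified
field). [cite: Siche2026, Theorem 1.2 p. 1 («u₀ ∈ H¹(T³; R³)»)] -/
def H1norm (v : T3 → E3) : ℝ :=
  Torus.sobolevNorm 1 (EuclideanSpace.complexify ∘ v)

/-! ## §E. The claimed theorem (Thm 1.2 p. 1) -/

/-- **The claimed theorem** (Theorem 1.2 p. 1, verbatim in the module docstring), on the unit torus:
for every `ν > 0`, every `H¹` weakly divergence-free datum `u₀` and EVERY global Leray–Hopf weak solution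
`u` from `u₀` of the unforced system, `u` «∈ C^∞(T³ × (0,∞))» with a smooth pressure — typed as: `u`
agrees a.e. on every slice `t > 0` with a classical solution `(v, p)` on `(0, ∞) × 𝕋³` (a Leray–Hopf
solution is an a.e.-defined object; smoothness means a smooth representative solving (1) classically) —
and any two Leray–Hopf solutions from `u₀` agree a.e. on every slice `t > 0` («the Leray–Hopf weak
solution is unique»). [cite: Siche2026, Theorem 1.2 p. 1; §1.1 p. 1] -/
def ClaimedTheorem : Prop :=
  ∀ ν : ℝ, 0 < ν →
    ∀ u₀ : T3 → E3, Torus.MemSobolev 1 (EuclideanSpace.complexify ∘ u₀) → Torus.IsWeaklyDivFree u₀ →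
      ∀ u : ℝ → T3 → E3, Torus.IsGlobalLerayHopf ν 0 u₀ u →
        (∃ (v : ℝ → T3 → E3) (p : ℝ → T3 → ℝ),
            Torus.IsClassicalNSSolutionOn (Ioi 0) ν 0 v p ∧ ∀ t : ℝ, 0 < t → u t =ᵐ[volume] v t) ∧
          ∀ u' : ℝ → T3 → E3, Torus.IsGlobalLerayHopf ν 0 u₀ u' → ∀ t : ℝ, 0 < t → u' t =ᵐ[volume] u t

/-! ## §F. The steps -/

/-- **Step 1 — Forcing disjointness** (Thm 5.2 p. 8): «For any k ≠ l in ℤ³₀, the forcing sets are exactly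
disjoint: F(k) ∩ F(l) = ∅.» (footnote 5: «This is an arithmetic identity, not a bound».)
[cite: Siche2026, Theorem 5.2 p. 8; Definition 5.1 p. 8] -/
def Step1_forcingDisjoint : Prop :=
  ∀ k l : Z3, k ≠ 0 → l ≠ 0 → k ≠ l → forcingSet k ∩ forcingSet l = ∅

/-- Step 1 holds (the pair `(p, q)` determines `k = −(p+q)`) — a kernel record that this step is
content-free arithmetic, as the print itself says (footnote 5 p. 8). [cite: Siche2026, Theorem 5.2 proof p. 8] -/
theorem step1_holds : Step1_forcingDisjoint := by
  intro k l _ _ hkl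
  ext pq
  simp only [forcingSet, mem_inter_iff, mem_setOf_eq, mem_empty_iff_false, iff_false, not_and, and_imp]
  intro _ _ hk _ _ hl
  apply hkl
  have h1 : k = -(pq.1 + pq.2) := by rw [add_assoc] at hk; exact eq_neg_of_add_eq_zero_left hk
  have h2 : l = -(pq.1 + pq.2) := by rw [add_assoc] at hl; exact eq_neg_of_add_eq_zero_left hl
  rw [h1, h2]

/-- **Step 2 — Inter-mode dephasing** (Prop. 5.9 p. 10): «For shells K ≥ K₀ (with K₀ = 5 the base shell) …
Full dephasing (∆φ ∼ 2π) occurs at τ_dec(K) = O(1/(U K^{1/2})), after which χ_K = O(1) regardless of the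
initial phase configuration», «U ≤ √(2E₀) is the sweeping velocity, bounded by energy conservation». Typed
with universal implied constants (`C_dec` for the `O(1/(U K^{1/2}))`, `C_χ` for the `O(1)`), `U := √(2E₀)`,
`E₀ = E(u(0))`, along classical solutions on `[0, T) × 𝕋³`: for `t ≥ C_dec/(√(2E₀) √K)` the shell coherence is
`≤ C_χ`. (Remark 5.8 p. 10 rests the «every smooth initial datum» claim of (30) on this.)
[cite: Siche2026, Proposition 5.9 (31) p. 10; Remark 5.8 p. 10] -/
def Step2_dephasing : Prop :=
  ∃ Cdec Cχ : ℝ, 0 < Cdec ∧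
    ∀ ν : ℝ, 0 < ν → ∀ (T : ℝ) (U : ℝ → T3 → E3) (P : ℝ → T3 → ℝ),
      Torus.IsClassicalNSSolutionOn (Ico 0 T) ν 0 U P →
        ∀ K : ℕ, 5 ≤ K → shell K ≠ ∅ →
          ∀ t ∈ Ico 0 T, Cdec / (Real.sqrt (2 * Torus.kineticEnergy (U 0)) * Real.sqrt K) ≤ t →
            coherence (U t) K 0 ≤ Cχ

/-- **Step 3 — Contraction along the flow** (Lemma 6.7 p. 14: «For every smooth bath trajectory B(t), the
on-shell magnetization satisfies f_K(R; B(·)) < R for all K ≥ 3 and all R > R*», with `R* = C₀/((1−c)√N_K)`,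
`c < 1` the universal contraction constant of Theorem 6.4 (35) p. 12 («f_K(R; B) ≤ cR + C₀/√N_K … for all
shells S_K with K ≥ 3 and every bath configuration»; Step 3 of its proof uses the deterministic floor
`1/√N_K`, `C₀ = √(π/4)` in expectation), `f_K(R; B) = |m_K(t+τ)|` given `|m_K(t)| = R` (Def. 6.1 (32) p. 11),
`τ = τ_K` «one eddy turnover time for shell K» ((33); Prop. 6.29 (2) p. 22)). Typed as printed in Lemma 6.7,
at the weakest faithful grain: universal `c ∈ [0,1)`, `C₀ ≥ 0`; for each viscosity a POSITIVE relaxation time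
`τ(K, u(0))` (shell- and flow-dependent); along every classical solution and every `K ≥ 3`, whenever
`|m_K(t)| > R*` and `t + τ` is still in the window, `|m_K(t + τ)| < |m_K(t)|`.
[cite: Siche2026, Lemma 6.7 p. 14; Theorem 6.4 (35) p. 12; Definition 6.1 (32)–(33) p. 11; Proposition 6.29 (2) p. 22] -/
def Step3_contraction : Prop :=
  ∃ c C₀ : ℝ, 0 ≤ c ∧ c < 1 ∧ 0 ≤ C₀ ∧
    ∀ ν : ℝ, 0 < ν → ∃ τ : ℕ → (T3 → E3) → ℝ, (∀ K U₀, 0 < τ K U₀) ∧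
      ∀ (T : ℝ) (U : ℝ → T3 → E3) (P : ℝ → T3 → ℝ),
        Torus.IsClassicalNSSolutionOn (Ico 0 T) ν 0 U P →
          ∀ K : ℕ, 3 ≤ K → ∀ t ∈ Ico 0 T, t + τ K (U 0) ∈ Ico 0 T →
            C₀ / ((1 - c) * Real.sqrt (shellModes K)) < ‖magnetization (U t) K 0‖ →
              ‖magnetization (U (t + τ K (U 0))) K 0‖ < ‖magnetization (U t) K 0‖

/-- **Step 4 — Global decoherence** (Thm 6.28 (51) p. 22: «For the Navier–Stokes equations (1) on T³ with
ν > 0 and u₀ ∈ H¹: sup_{K≥1} χ_K(t) = O(1) for all t > 0, where the bound depends on ‖u₀‖_{H¹} and ν but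
not on K»). DECL OF RECORD, per-solution form (referee ref-3 g3: `∃ C ∀ t ∀ K`): along every classical
solution of the unforced system on `[0, T) × 𝕋³` there is `C` with `χ_K(t) ≤ C` for all `0 < t < T` and all
shells `K`. [cite: Siche2026, Theorem 6.28 (51) p. 22] -/
def Step4_globalDecoherence : Prop :=
  ∀ ν : ℝ, 0 < ν → ∀ (T : ℝ) (U : ℝ → T3 → E3) (P : ℝ → T3 → ℝ),
    Torus.IsClassicalNSSolutionOn (Ico 0 T) ν 0 U P →
      ∃ C : ℝ, ∀ t ∈ Ioo 0 T, ∀ K : ℕ, coherence (U t) K 0 ≤ C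

/-- Step 4 with the PRINTED dependence of the constant: `C = C(‖u₀‖_{H¹}, ν)` («depends on ‖u₀‖_{H¹} and ν
but not on K»), i.e. one function of the datum's `H¹` norm per viscosity. [cite: Siche2026, Theorem 6.28 (51) p. 22] -/
def Step4_print : Prop :=
  ∀ ν : ℝ, 0 < ν → ∃ C : ℝ → ℝ, ∀ (T : ℝ) (U : ℝ → T3 → E3) (P : ℝ → T3 → ℝ),
    Torus.IsClassicalNSSolutionOn (Ico 0 T) ν 0 U P →
      ∀ t ∈ Ioo 0 T, ∀ K : ℕ, coherence (U t) K 0 ≤ C (H1norm (U 0))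

/-- The printed form of Step 4 implies the form of record. [cite: Siche2026, Theorem 6.28 (51) p. 22] -/
theorem step4_of_print (h : Step4_print) : Step4_globalDecoherence := by
  intro ν hν T U P hsol
  obtain ⟨C, hC⟩ := h ν hν
  exact ⟨C (H1norm (U 0)), hC T U P hsol⟩

/-- **Step 5 — Uniform Shifted Coherence** (Thm 7.1 (52)–(53) p. 23: «Under the global decoherence conditions
(Theorem 6.28) … Then there exists C > 0 (depending on ‖u₀‖_{H¹} and ν but not on K or x) such that
χ_K(x) ≤ C for all K, all x ∈ T³, all t > 0»), per-solution form: the `x = 0` coherence bound of Step 4 along a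
classical solution transfers to every spatial shift `x`. [cite: Siche2026, Theorem 7.1 (52)–(53) p. 23] -/
def Step5_shiftedCoherence : Prop :=
  ∀ ν : ℝ, 0 < ν → ∀ (T : ℝ) (U : ℝ → T3 → E3) (P : ℝ → T3 → ℝ),
    Torus.IsClassicalNSSolutionOn (Ico 0 T) ν 0 U P →
      (∃ C : ℝ, ∀ t ∈ Ioo 0 T, ∀ K : ℕ, coherence (U t) K 0 ≤ C) →
        ∃ C' : ℝ, ∀ t ∈ Ioo 0 T, ∀ (K : ℕ) (x : T3), coherence (U t) K x ≤ C'

/-- Step 5 with the PRINTED dependence `C' = C'(‖u₀‖_{H¹}, ν)` given `C = C(‖u₀‖_{H¹}, ν)`.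
[cite: Siche2026, Theorem 7.1 (53) p. 23] -/
def Step5_print : Prop :=
  ∀ ν : ℝ, 0 < ν → ∀ C : ℝ → ℝ, ∃ C' : ℝ → ℝ, ∀ (T : ℝ) (U : ℝ → T3 → E3) (P : ℝ → T3 → ℝ),
    Torus.IsClassicalNSSolutionOn (Ico 0 T) ν 0 U P →
      (∀ t ∈ Ioo 0 T, ∀ K : ℕ, coherence (U t) K 0 ≤ C (H1norm (U 0))) →
        ∀ t ∈ Ioo 0 T, ∀ (K : ℕ) (x : T3), coherence (U t) K x ≤ C' (H1norm (U 0))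

/-- **Step 6 — Pointwise vorticity bound** (Prop. 7.2 (59) p. 24: «If χ_K(x) ≤ C_χ uniformly in K and x, then
‖ω(t)‖_∞ ≤ C(ν, E₀) · Ω(t)^{1/2}, where Ω(t) = ‖ω(t)‖²_{L²} is the enstrophy and C(ν, E₀) depends on C_χ, ν,
E₀, and universal constants»), AT FIELD GRAIN, squared: for each `ν > 0` a function `C(E₀, C_χ)` such that
every smooth divergence-free field `v` on 𝕋³ with kinetic energy `≤ E₀` and all shell coherences `≤ C_χ` has
`|ω(x)|² ≤ C² · Ω` at every point (`|ω(x)|² = torusVorticitySqAt v x`, `Ω = ‖∇v‖²_{L²} = Torus.gradNormSq v`,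
`= ‖ω‖²_{L²}` for divergence-free periodic fields). The printed proof absorbs «a factor K_max^{1/2} where
K_max ∼ Re^{3/4} … is fixed by initial data» into `C` — no such truncation is a hypothesis of the statement,
and none is typed. [cite: Siche2026, Proposition 7.2 (59)–(61) p. 24; Remark 7.4 p. 25] -/
def Step6_vorticityBound : Prop :=
  ∀ ν : ℝ, 0 < ν → ∃ C : ℝ → ℝ → ℝ, ∀ (E₀ Cχ : ℝ) (v : T3 → E3),
    Torus.IsSmooth v → Torus.IsDivFree v → Torus.kineticEnergy v ≤ E₀ →
      (∀ (K : ℕ) (x : T3), coherence v K x ≤ Cχ) →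
        ∀ x : T3, torusVorticitySqAt v x ≤ C E₀ Cχ ^ 2 * Torus.gradNormSq v

/-- **Step 6 as consumed** («Proof of Theorem 1.2», Step 2 p. 25: «By Proposition 7.2 and the Uniform Shifted
Coherence theorem (Theorem 7.1): ‖ω(t)‖_∞ ≤ C(ν, E₀) · Ω(t)^{1/2}»): along every classical solution on
`[0, T) × 𝕋³`, `|ω(t, x)|² ≤ C² Ω(t)` for `0 < t < T`, with the printed dependence `C = C(ν, E₀)`, «C(ν, E₀)
depends on C_χ, ν, E₀», `C_χ = C_χ(‖u₀‖_{H¹}, ν)` (Thm 7.1) — i.e. `C = C(‖u₀‖_{H¹}, E₀)` per viscosity,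
`E₀ = E(u(0))`. Recorded ALONGSIDE the field-grain statement; it follows from the printed forms of Steps 4–6
(`step6_used_of_print`). [cite: Siche2026, §8 Proof of Theorem 1.2, Step 2 p. 25] -/
def Step6_used : Prop :=
  ∀ ν : ℝ, 0 < ν → ∃ C : ℝ → ℝ → ℝ, ∀ (T : ℝ) (U : ℝ → T3 → E3) (P : ℝ → T3 → ℝ),
    Torus.IsClassicalNSSolutionOn (Ico 0 T) ν 0 U P →
      ∀ t ∈ Ioo 0 T, ∀ x : T3,
        torusVorticitySqAt (U t) x ≤
          C (H1norm (U 0)) (Torus.kineticEnergy (U 0)) ^ 2 * Torus.gradNormSq (U t)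

/-- **Step 7 — Enstrophy closure** (Thm 7.3 (62)–(64) p. 25: «dΩ/dt ≤ c₁Ω^{3/2} − νc₂Ω²», `c₂ = 1/E₀` from
«Ω² ≤ 2E·‖∇ω‖², where E = ½‖u‖² ≤ E₀ by energy dissipation», stretching `|⟨ω, ω·∇u⟩| ≤ ‖ω‖_∞‖ω‖²₂ ≤
C(ν,E₀)Ω^{3/2}` «using Proposition 7.2»; conclusion «Ω* = c₁²E₀²/ν². For Ω > Ω* we have dΩ/dt < 0. Therefore
Ω(t) ≤ max(Ω(0), Ω*) for all t ≥ 0»): typed as the a priori conclusion along a classical solution on `[0, T)`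
with energy `≤ E₀` and the pointwise vorticity bound `|ω|² ≤ C₁²Ω` on `(0, T)` — `Ω(t) ≤ max(Ω(0), Ω*(E₀, C₁))`
on `[0, T)`. [cite: Siche2026, Theorem 7.3 (62)–(64) p. 25] -/
def Step7_enstrophyClosure : Prop :=
  ∀ ν : ℝ, 0 < ν → ∃ Ωstar : ℝ → ℝ → ℝ, ∀ (E₀ C₁ : ℝ) (T : ℝ) (U : ℝ → T3 → E3) (P : ℝ → T3 → ℝ),
    Torus.IsClassicalNSSolutionOn (Ico 0 T) ν 0 U P →
      (∀ t ∈ Ico 0 T, Torus.kineticEnergy (U t) ≤ E₀) →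
        (∀ t ∈ Ioo 0 T, ∀ x : T3, torusVorticitySqAt (U t) x ≤ C₁ ^ 2 * Torus.gradNormSq (U t)) →
          ∀ t ∈ Ico 0 T, Torus.gradNormSq (U t) ≤ max (Torus.gradNormSq (U 0)) (Ωstar E₀ C₁)

/-- **The a priori enstrophy bound** delivered by Steps 4–7 («Step 3 (Enstrophy closure). By Theorem 7.3, the
enstrophy remains bounded: sup_{t>0} Ω(t) < ∞», p. 25), per classical solution on each `[0, T) × 𝕋³`. By the
tree's `ClayVariants.clayPeriodic_regularity_iff_aprioriEnstrophyBound` this is Clay (B) in substance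
(`clay_of_apriori`). [cite: Siche2026, §8 Proof of Theorem 1.2, Step 3 p. 25] -/
def AprioriEnstrophy : Prop :=
  ∀ ν : ℝ, 0 < ν → ∀ (T : ℝ) (U : ℝ → T3 → E3) (P : ℝ → T3 → ℝ),
    Torus.IsClassicalNSSolutionOn (Ico 0 T) ν 0 U P →
      ∃ B : ℝ, ∀ t ∈ Ico 0 T, Torus.gradNormSq (U t) ≤ B

/-- **Step 8 — From the a priori bound to Theorem 1.2** (§8 «Proof of Theorem 1.2» Steps 3–5 p. 25–26: BKM
«[4, Theorem 1] … Therefore no blowup occurs», «standard parabolic regularity [36, 28] bootstraps to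
u ∈ C^∞(T³ × (0,∞))»; §8.1 Prop. 8.1 + «Galerkin passage» Steps 1–3 p. 26 (Aubin–Lions); Step 4 p. 26
«Uniqueness across all Leray–Hopf solutions … weak–strong uniqueness theorem [36, Theorem III.3.7]»): the a
priori enstrophy bound along classical solutions yields the claimed theorem for `H¹` data and all Leray–Hopf
solutions. TRUE in the classical theory (a priori bound ⇒ (B) ⇒ global classical solutions from the smooth
slices of the local strong solution ⇒ smoothness and uniqueness by weak–strong uniqueness); typed, not
proved; not the predicted locus. [cite: Siche2026, §8 p. 25–27; Proposition 8.1 p. 26] -/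
def Step8_regularity : Prop :=
  AprioriEnstrophy → ClaimedTheorem

/-! ## §G. Composition (what composes is PROVED; what does not is recorded in the module docstring) -/

/-- Energy does not increase along a classical solution of the unforced system on `[0, T) × 𝕋³` (`ν ≥ 0`):
`E(u(t)) ≤ E(u(0))` — the time integral of the tree's energy balance
`Torus.IsClassicalNSSolutionOn.energy_balance_holds` (`dE/dt = −ν‖∇u‖²` within `[0, T)`), the input
«E = ½‖u‖² ≤ E₀ by energy dissipation» of Thm 7.3 p. 25 and of `U ≤ √(2E₀)` in Prop. 5.9 p. 10.
[cite: Siche2026, Theorem 7.3 proof p. 25 («E ≤ E₀ by energy dissipation»)] [cite: DoeringFoias2002, §2 eq. (2.4)] -/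
theorem kineticEnergy_le_initial {ν T : ℝ} (hν : 0 ≤ ν) {U : ℝ → T3 → E3} {P : ℝ → T3 → ℝ}
    (h : Torus.IsClassicalNSSolutionOn (Ico 0 T) ν 0 U P) {t : ℝ} (ht : t ∈ Ico 0 T) :
    Torus.kineticEnergy (U t) ≤ Torus.kineticEnergy (U 0) := by
  have hconv : Convex ℝ (Ico (0 : ℝ) T) := convex_Ico 0 T
  have hd : ∀ s ∈ Ico (0 : ℝ) T, HasDerivWithinAt (fun r => Torus.kineticEnergy (U r))
      (-ν * Torus.gradNormSq (U s)) (Ico 0 T) s := by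
    intro s hs
    have hb := Torus.IsClassicalNSSolutionOn.energy_balance_holds h hconv hs
    simpa using hb
  have hanti : AntitoneOn (fun r => Torus.kineticEnergy (U r)) (Ico 0 T) := by
    refine antitoneOn_of_hasDerivWithinAt_nonpos hconv (fun s hs => (hd s hs).continuousWithinAt)
      (f' := fun s => -ν * Torus.gradNormSq (U s)) ?_ ?_
    · intro s hs
      rw [interior_Ico] at hs ⊢
      exact (hd s (Ioo_subset_Ico_self hs)).mono Ioo_subset_Ico_self
    · intro s _
      have hg : 0 ≤ Torus.gradNormSq (U s) :=
        integral_nonneg fun x => Finset.sum_nonneg fun i _ => sq_nonneg _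
      nlinarith
  exact hanti (left_mem_Ico.2 (ht.1.trans_lt ht.2)) ht ht.1

/-- **Steps 4–7 ⇒ the a priori enstrophy bound** (the chain «Proof of Theorem 1.2» Steps 1–3 p. 25:
decoherence ⇒ shifted coherence ⇒ pointwise vorticity bound on every slice ⇒ enstrophy closure), PROVED over
the tree's energy monotonicity. [cite: Siche2026, §8 Proof of Theorem 1.2, Steps 1–3 p. 25] -/
theorem apriori_of_steps (h4 : Step4_globalDecoherence) (h5 : Step5_shiftedCoherence)
    (h6 : Step6_vorticityBound) (h7 : Step7_enstrophyClosure) : AprioriEnstrophy := by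
  intro ν hν T U P hsol
  obtain ⟨C', hC'⟩ := h5 ν hν T U P hsol (h4 ν hν T U P hsol)
  obtain ⟨C6, hC6⟩ := h6 ν hν
  obtain ⟨Ωs, hΩs⟩ := h7 ν hν
  have hE : ∀ t ∈ Ico 0 T, Torus.kineticEnergy (U t) ≤ Torus.kineticEnergy (U 0) :=
    fun t ht => kineticEnergy_le_initial hν.le hsol ht
  have hvort : ∀ t ∈ Ioo 0 T, ∀ x : T3,
      torusVorticitySqAt (U t) x ≤ C6 (Torus.kineticEnergy (U 0)) C' ^ 2 * Torus.gradNormSq (U t) :=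
    fun t ht x => hC6 _ C' (U t) (hsol.smooth_velocity.isSmooth_slice (Ioo_subset_Ico_self ht))
      (hsol.divFree t (Ioo_subset_Ico_self ht)) (hE t (Ioo_subset_Ico_self ht)) (hC' t ht) x
  exact ⟨max (Torus.gradNormSq (U 0)) (Ωs (Torus.kineticEnergy (U 0)) (C6 (Torus.kineticEnergy (U 0)) C')),
    fun t ht => hΩs _ _ T U P hsol hE hvort t ht⟩

/-- **Steps 4–6 in their printed dependence ⇒ Step 6 as consumed** («Step 2» p. 25, with
`C = C(‖u₀‖_{H¹}, E₀, ν)`). [cite: Siche2026, §8 Proof of Theorem 1.2, Step 2 p. 25] -/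
theorem step6_used_of_print (h4 : Step4_print) (h5 : Step5_print) (h6 : Step6_vorticityBound) :
    Step6_used := by
  intro ν hν
  obtain ⟨C4, hC4⟩ := h4 ν hν
  obtain ⟨C5, hC5⟩ := h5 ν hν C4
  obtain ⟨C6, hC6⟩ := h6 ν hν
  refine ⟨fun h e => C6 e (C5 h), fun T U P hsol t ht x => ?_⟩
  have hE : Torus.kineticEnergy (U t) ≤ Torus.kineticEnergy (U 0) :=
    kineticEnergy_le_initial hν.le hsol (Ioo_subset_Ico_self ht)
  exact hC6 _ _ (U t) (hsol.smooth_velocity.isSmooth_slice (Ioo_subset_Ico_self ht))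
    (hsol.divFree t (Ioo_subset_Ico_self ht)) hE (hC5 T U P hsol (hC4 T U P hsol) t ht) x

/-- The printed form of Step 5 implies the per-solution form (constant function in, function value out).
[cite: Siche2026, Theorem 7.1 (53) p. 23] -/
theorem step5_of_print (h : Step5_print) : Step5_shiftedCoherence := by
  intro ν hν T U P hsol hC
  obtain ⟨C, hC⟩ := hC
  obtain ⟨C', hC'⟩ := h ν hν fun _ => C
  exact ⟨C' (H1norm (U 0)), hC' T U P hsol hC⟩

/-- **The a priori bound at one viscosity gives Clay (B) at that viscosity** — in the kernel, by the tree's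
maximal classical solution with the enstrophy blow-up alternative on `𝕋³` (any mean) and the torus form of
(B). [cite: RobinsonRodrigoSadowskiCUP2016, §6.3 p. 108 and §8.1 p. 122] [cite: FeffermanClay2006, (B) p. 2] -/
theorem clayAt_of_apriori (h : AprioriEnstrophy) {ν : ℝ} (hν : 0 < ν) : clayPeriodic.RegularityAt ν := by
  rw [clayPeriodic_regularityAt_iff_torus hν]
  intro U₀ hs hd
  obtain ⟨u, p, hu0, hcases⟩ :=
    Torus.exists_maximal_classicalNS_anyMean (d := Fin 3) (by simp) hν hs hd
  rcases hcases with ⟨hglob, -⟩ | ⟨T, -, hsol, hnb, -⟩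
  · exact ⟨u, p, hglob, hu0⟩
  · obtain ⟨B, hB⟩ := h ν hν T u p hsol
    refine absurd ⟨B, ?_⟩ hnb
    rintro _ ⟨t, ht, rfl⟩
    exact hB t ht

/-- **The a priori enstrophy bound IS Clay (B) in substance.** [cite: FeffermanClay2006, (B) p. 2] -/
theorem clay_of_apriori (h : AprioriEnstrophy) : clayPeriodic.Regularity :=
  fun _ hν => clayAt_of_apriori h hν

/-- **Steps 4–7 ⇒ Clay (B)** — the decisive content of the paper sits in Steps 4–7 (§6–§7); Step 8 (§8) is
not needed for (B). [cite: Siche2026, §8 p. 25] [cite: FeffermanClay2006, (B) p. 2] -/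
theorem clay_of_steps (h4 : Step4_globalDecoherence) (h5 : Step5_shiftedCoherence)
    (h6 : Step6_vorticityBound) (h7 : Step7_enstrophyClosure) : clayPeriodic.Regularity :=
  clay_of_apriori (apriori_of_steps h4 h5 h6 h7)

/-- **Composition** («the six-step chain announced in Section 1.5 has been executed», p. 27): PROVED along the
kernel chain Step 4 → 5 → 6 → 7 → (a priori bound) → Step 8. Steps 1–3 are the printed grounds FOR Step 4
(Thm 6.28's induction, §6.8 p. 22) and enter as hypotheses only; the implication Steps 1–3 ⇒ Step 4 is not
reproduced (module docstring, COMPOSITION NOTE). [cite: Siche2026, §1.5 (3) p. 3; §8 p. 25–27] -/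
theorem claim_of_steps (_h1 : Step1_forcingDisjoint) (_h2 : Step2_dephasing) (_h3 : Step3_contraction)
    (h4 : Step4_globalDecoherence) (h5 : Step5_shiftedCoherence) (h6 : Step6_vorticityBound)
    (h7 : Step7_enstrophyClosure) (h8 : Step8_regularity) : ClaimedTheorem :=
  h8 (apriori_of_steps h4 h5 h6 h7)

/-! ## §H. Kernel records about the typed objects (nothing here asserts a step) -/

/-- `|e^{2πik·x}| = 1` (private helper). [folklore] -/
private theorem norm_mFourier_apply (n : Z3) (x : T3) : ‖UnitAddTorus.mFourier n x‖ = 1 := by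
  simp only [UnitAddTorus.mFourier, ContinuousMap.coe_mk, norm_prod]
  exact Finset.prod_eq_one fun i _ => by simp

/-- **`|m_K(x)| ≤ 1`** (triangle inequality: `|Σ_{k,σ} c^σ_k e^{2πik·x}| ≤ Σ_{k,σ} |c^σ_k| = N_K ā_K`), hence
`χ_K(x) ≤ N_K` for every field, shell and shift — the print's «For fully coherent (aligned) phases, χ_K = N_K»
is the maximum. In particular a shell with few lattice points satisfies any coherence hypothesis
`χ_K ≤ C_χ` with `C_χ ≥ N_K` trivially. [cite: Siche2026, Definition 4.1 p. 7] -/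
theorem norm_magnetization_le_one (v : T3 → E3) (K : ℕ) (x : T3) : ‖magnetization v K x‖ ≤ 1 := by
  unfold magnetization
  set S : ℝ := ∑ k ∈ shell K, (‖helCoeff v k true‖ + ‖helCoeff v k false‖) with hS
  have hS0 : 0 ≤ S := Finset.sum_nonneg fun k _ => add_nonneg (norm_nonneg _) (norm_nonneg _)
  have hsum : ‖∑ k ∈ shell K, UnitAddTorus.mFourier k x * (helCoeff v k true + helCoeff v k false)‖ ≤ S := by
    refine (norm_sum_le _ _).trans (Finset.sum_le_sum fun k _ => ?_)
    rw [norm_mul, norm_mFourier_apply, one_mul]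
    exact norm_add_le _ _
  have hNa : (shellModes K : ℂ) * (meanAmp v K : ℂ) = ((shellModes K : ℝ) * meanAmp v K : ℝ) := by
    push_cast; ring
  by_cases hN : (shellModes K : ℝ) = 0
  · have : (shellModes K : ℂ) * (meanAmp v K : ℂ) = 0 := by rw [hNa, hN, zero_mul]; simp
    rw [this, inv_zero, zero_mul, norm_zero]
    exact zero_le_one
  · have hprod : (shellModes K : ℝ) * meanAmp v K = S := by
      unfold meanAmp
      rw [← hS, ← mul_assoc, mul_inv_cancel₀ hN, one_mul]
    rw [hNa, hprod, norm_mul, norm_inv, Complex.norm_real, Real.norm_of_nonneg hS0]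
    by_cases hS' : S = 0
    · rw [hS', inv_zero, zero_mul]; exact zero_le_one
    · rw [inv_mul_le_iff₀ (lt_of_le_of_ne hS0 (Ne.symm hS')), mul_one]
      exact hsum

/-- **`χ_K(x) ≤ N_K`** for every field, shell and point. [cite: Siche2026, Definition 4.1 p. 7 («For fully coherent
(aligned) phases, χ_K = N_K»)] -/
theorem coherence_le_shellModes (v : T3 → E3) (K : ℕ) (x : T3) : coherence v K x ≤ shellModes K := by
  unfold coherence
  have h1 : ‖magnetization v K x‖ ^ 2 ≤ 1 := by
    have := norm_magnetization_le_one v K x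
    nlinarith [norm_nonneg (magnetization v K x)]
  calc (shellModes K : ℝ) * ‖magnetization v K x‖ ^ 2 ≤ (shellModes K : ℝ) * 1 :=
        mul_le_mul_of_nonneg_left h1 (Nat.cast_nonneg _)
    _ = shellModes K := mul_one _

/-- **`ClaimedTheorem ⇒ Clay (B)`** — PROVED, no wrong-problem delta: for a smooth divergence-free datum on
`𝕋³`, Hopf's theorem (tree `hopf_existence_torus_holds`) gives a global Leray–Hopf solution, the claimed
theorem makes it agree a.e. with a classical solution on `(0, ∞)`, weak–strong uniqueness
(`Torus.IsLerayHopfOn.ae_eq_of_isClassicalNSSolutionOn`, RRS 2016 Thm 6.10) identifies both with the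
maximal classical solution from the datum (`Torus.exists_maximal_classicalNS_anyMean`, RRS 2016 §6.3/§8.1)
on its interval, whose enstrophy therefore stays bounded — so it is global, which is (B) in torus form
(`clayPeriodic_regularityAt_iff_torus`). [cite: Siche2026, Theorem 1.2 p. 1; §1.1 p. 1 («This is Problem (B)»)]
[cite: RobinsonRodrigoSadowskiCUP2016, Thm 4.4, Thm 6.10, §6.3, §8.1] [cite: FeffermanClay2006, (B) p. 2] -/
theorem clay_of_claimed (h : ClaimedTheorem) : clayPeriodic.Regularity := by
  intro ν hν
  rw [clayPeriodic_regularityAt_iff_torus hν]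
  intro U₀ hs hd
  obtain ⟨w, q, hw0, hcases⟩ :=
    Torus.exists_maximal_classicalNS_anyMean (d := Fin 3) (by simp) hν hs hd
  rcases hcases with ⟨hglob, -⟩ | ⟨T, hT, hsol, hnb, -⟩
  · exact ⟨w, q, hglob, hw0⟩
  · exfalso
    -- Hopf: a global Leray–Hopf solution from `U₀`
    have hL2 : MemLp U₀ 2 volume := hs.memLp 2
    have hwdiv : Torus.IsWeaklyDivFree U₀ := Torus.IsDivFree.isWeaklyDivFree_holds hs hd
    have hmeas : AEStronglyMeasurable (Torus.stLift (0 : ℝ → T3 → E3))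
        (volume.restrict (Ioi 0 ×ˢ univ)) := by
      have : Torus.stLift (0 : ℝ → T3 → E3) = fun _ => 0 := rfl
      rw [this]
      exact aestronglyMeasurable_const
    have hfin : ∀ T' : ℝ, 0 < T' → ∫⁻ t in Ioo 0 T', ∫⁻ x, ‖(0 : ℝ → T3 → E3) t x‖ₑ ^ 2 < ⊤ := by
      intro T' _
      simp
    obtain ⟨u, hu⟩ := hopf_existence_torus_holds ν hν U₀ hL2 hwdiv 0 hmeas hfin
    -- the claimed theorem: `u` is a.e. a classical solution on `(0, ∞)`
    have hH1 : Torus.MemSobolev 1 (EuclideanSpace.complexify ∘ U₀) :=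
      Torus.IsSmooth.memSobolev_holds hs.complexify_comp 1
    obtain ⟨v, p, hv, huv⟩ := (h ν hν U₀ hH1 hwdiv u hu).1
    -- weak–strong uniqueness against the maximal solution on `(0, T)`
    have huw : ∀ t ∈ Ioo 0 T, u t =ᵐ[volume] w t := by
      intro t ht
      have hLH : Torus.IsLerayHopfOn t ν 0 (w 0) u := by
        rw [hw0]
        exact hu t ht.1
      exact hLH.ae_eq_of_isClassicalNSSolutionOn hsol (convex_Ico 0 T) (Icc_subset_Ico_right ht.2)
        hν.le ht.1 t ⟨ht.1, le_rfl⟩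
    have hvw : ∀ t ∈ Ioo 0 T, v t = w t := by
      intro t ht
      have hae : v t =ᵐ[volume] w t := (huv t ht.1).symm.trans (huw t ht)
      have hvc : Continuous (v t) :=
        (hv.smooth_velocity.isSmooth_slice (show t ∈ Ioi (0 : ℝ) from ht.1)).continuous
      have hwc : Continuous (w t) :=
        (hsol.smooth_velocity.isSmooth_slice (Ioo_subset_Ico_self ht)).continuous
      exact (Continuous.ae_eq_iff_eq volume hvc hwc).1 hae
    -- enstrophy of `w` on `[0, T/2]` and of `v` on `[T/2, T]` is bounded (continuity on compacts)
    have hT2 : 0 < T / 2 := half_pos hT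
    have hT2' : T / 2 < T := half_lt_self hT
    have hw1 : Torus.IsClassicalNSSolutionOn (Icc 0 (T / 2)) ν 0 w q :=
      hsol.mono (Icc_subset_Ico_right hT2') (uniqueDiffOn_Icc hT2)
    have hv1 : Torus.IsClassicalNSSolutionOn (Icc (T / 2) T) ν 0 v p :=
      hv.mono (fun s hs => lt_of_lt_of_le hT2 hs.1) (uniqueDiffOn_Icc hT2')
    have hcw : ContinuousOn (fun s => 2⁻¹ * Torus.gradNormSq (w s)) (Icc 0 (T / 2)) :=
      fun s hs => (hw1.hasDerivWithinAt_half_gradNormSq hT2 hs).continuousWithinAt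
    have hcv : ContinuousOn (fun s => 2⁻¹ * Torus.gradNormSq (v s)) (Icc (T / 2) T) :=
      fun s hs => (hv1.hasDerivWithinAt_half_gradNormSq hT2' hs).continuousWithinAt
    obtain ⟨B₁, hB₁⟩ := isCompact_Icc.bddAbove_image hcw
    obtain ⟨B₂, hB₂⟩ := isCompact_Icc.bddAbove_image hcv
    refine hnb ⟨max (2 * B₁) (2 * B₂), ?_⟩
    rintro _ ⟨t, ht, rfl⟩
    show Torus.gradNormSq (w t) ≤ max (2 * B₁) (2 * B₂)
    rcases le_or_gt t (T / 2) with hle | hle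
    · have h1 : 2⁻¹ * Torus.gradNormSq (w t) ≤ B₁ := hB₁ ⟨t, ⟨ht.1, hle⟩, rfl⟩
      exact le_max_of_le_left (by linarith)
    · have htI : t ∈ Ioo 0 T := ⟨hT2.trans hle, ht.2⟩
      have h2 : 2⁻¹ * Torus.gradNormSq (v t) ≤ B₂ := hB₂ ⟨t, ⟨hle.le, ht.2.le⟩, rfl⟩
      rw [← hvw t htI]
      exact le_max_of_le_right (by linarith)

/-! ## §I. Print-earlier internal face (rev 2, additive; referee ref-3 g3 REF INPUT #4 05:13:17Z)

Inside the proof of Lemma 6.7 (Step B, p. 14 l.56–59) the print disposes of the shells where the contraction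
cannot act by a MODE-COUNTING sentence: «Shells with νK^{2/3} ≥ 1 − c lie in the dissipation range (K above
the Kolmogorov cutoff K_d ∼ ν^{−3/2}); these shells are viscously damped, do not participate in the energy
cascade, and satisfy χ_K ≤ N_K = O(1) by the trivial mode-counting bound.» The arithmetic content «N_K = O(1)
on the dissipation range» is typed below at its own grain (for each `ν > 0` and contraction constant `c < 1`, the
mode counts of the shells with `νK^{2/3} ≥ 1 − c` are bounded); it is the same defect as Step 4's seen from
inside the proof (`χ_K ≤ N_K` is the only bound there, `coherence_le_shellModes`, and `N_K` is unbounded along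
`K = 25^j`). Nothing asserted; keyed or not by the chair (§1g). -/

/-- **Face p. 14 — «dissipation-range shells satisfy χ_K ≤ N_K = O(1)»** (Lemma 6.7, proof Step B, p. 14
l.56–59): for every `ν > 0` and every contraction constant `c < 1`, the mode counts `N_K` of the shells in the
dissipation range `νK^{2/3} ≥ 1 − c` are bounded. [cite: Siche2026, Lemma 6.7 proof Step B p. 14] -/
def Face_p14_dissipationRangeCount : Prop :=
  ∀ ν : ℝ, 0 < ν → ∀ c : ℝ, c < 1 → ∃ N₀ : ℝ, ∀ K : ℕ,
    1 - c ≤ ν * (K : ℝ) ^ ((2 : ℝ) / 3) → (shellModes K : ℝ) ≤ N₀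

/-! ## In-file discharge of Step 7 (Theorem 7.3 (62)–(64) p. 25) — D-0026; statement unchanged

The enstrophy closure is proved exactly as printed: the `H¹` balance of a classical solution
(tree `Torus.IsClassicalNSSolutionOn.hasDerivWithinAt_half_gradNormSq`) with the dissipation
`−ν‖Δu‖₂²` KEPT, the vortex-stretching bound `∫⟪Δu,(u·∇)u⟫ ≤ ‖ω‖_∞ ‖∇u‖₂²` (Betchov's identity
and the pointwise Doering–Gibbon bound, tree `integral_sum_partialDeriv_cube_eq_zero`,
`sum_partialDeriv_cube_sub_stretch_le`), the interpolation (64) `‖∇u‖₂⁴ ≤ ‖u‖₂² ‖Δu‖₂²`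
(Parseval + Cauchy–Schwarz), and the absorbing-ball argument p. 25 l. 70–90. -/

/-- **(64) p. 25, the interpolation `Ω² ≤ 2E · ‖Δu‖₂²`**: `(‖∇v‖₂²)² ≤ (∫‖v‖²)(∫‖Δv‖²)` for a
smooth field on `𝕋³` (Parseval: `(∑ μₖ‖v̂ₖ‖²)² ≤ ∑‖v̂ₖ‖² · ∑ μₖ²‖v̂ₖ‖²`, `μₖ = 4π²|k|²`).
[cite: Siche2026, Thm 7.3 proof (64) p. 25] -/
theorem gradNormSq_sq_le_integral_mul_integral {v : T3 → E3} (hv : Torus.IsSmooth v) :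
    Torus.gradNormSq v ^ 2 ≤ (∫ y, ‖v y‖ ^ 2) * ∫ y, ‖Torus.laplacian v y‖ ^ 2 := by
  classical
  have hA := Torus.hasSum_freq_mul_norm_sq_mFourierCoeff hv
  have hB := Torus.hasSum_freq_sq_mul_norm_sq_mFourierCoeff hv
  have hK := Torus.hasSum_sq_norm_mFourierCoeff_complexify (hv.memLp 2)
  let f : (Fin 3 → ℤ) → ℝ := fun k => ‖UnitAddTorus.mFourierCoeff (EuclideanSpace.complexify ∘ v) k‖
  let g : (Fin 3 → ℤ) → ℝ := fun k =>
    4 * Real.pi ^ 2 * Torus.freqNormSq k * ‖UnitAddTorus.mFourierCoeff (EuclideanSpace.complexify ∘ v) k‖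
  have hf0 : ∀ k, 0 ≤ f k := fun k => norm_nonneg _
  have hg0 : ∀ k, 0 ≤ g k := fun k => by
    have := Torus.freqNormSq_nonneg k; positivity
  have hf2 : HasSum (fun k => f k ^ (2 : ℝ)) (∫ y, ‖v y‖ ^ 2) :=
    hK.congr_fun fun k => by simp only [f, Real.rpow_two]
  have hg2 : HasSum (fun k => g k ^ (2 : ℝ)) (∫ y, ‖Torus.laplacian v y‖ ^ 2) :=
    hB.congr_fun fun k => by simp only [g, Real.rpow_two]; ring
  have hfg : HasSum (fun k => f k * g k) (Torus.gradNormSq v) :=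
    hA.congr_fun fun k => by simp only [f, g]; ring
  have hCS := Real.inner_le_Lp_mul_Lq_tsum_of_nonneg Real.HolderConjugate.two_two hf0 hg0
    hf2.summable hg2.summable
  rw [hfg.tsum_eq, hf2.tsum_eq, hg2.tsum_eq] at hCS
  have h0 : 0 ≤ Torus.gradNormSq v := by rw [Torus.gradNormSq]; positivity
  have hX : 0 ≤ ∫ y, ‖v y‖ ^ 2 := by positivity
  have hY : 0 ≤ ∫ y, ‖Torus.laplacian v y‖ ^ 2 := by positivity
  have h2 := pow_le_pow_left₀ h0 hCS 2
  refine h2.trans (le_of_eq ?_)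
  rw [mul_pow, ← Real.sqrt_eq_rpow, ← Real.sqrt_eq_rpow, Real.sq_sqrt hX, Real.sq_sqrt hY]

/-- **(63) p. 25, the stretching bound `|S| ≤ ‖ω‖_∞ Ω`** in the form used by the `H¹` balance:
for a smooth divergence-free field on `𝕋³` with `|ω(x)|² ≤ M²`, `M ≥ 0`,
`∫⟪Δv, (v·∇)v⟫ ≤ M ‖∇v‖₂²` (Betchov `∫ tr(∇v)³ = 0` + the pointwise Doering–Gibbon bound).
[cite: Siche2026, Thm 7.3 proof (63) p. 25] -/
theorem integral_inner_laplacian_convect_le {v : T3 → E3} (hv : Torus.IsSmooth v)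
    (hdiv : Torus.IsDivFree v) {M : ℝ} (hM : 0 ≤ M) (hω : ∀ x, torusVorticitySqAt v x ≤ M ^ 2) :
    ∫ x, ⟪Torus.laplacian v x, Torus.convect v v x⟫ ≤ M * Torus.gradNormSq v := by
  have hd : Fintype.card (Fin 3) = 3 := Fintype.card_fin 3
  have hD : ∀ m, Torus.IsSmooth (Torus.partialDeriv m v) := fun m => hv.partialDeriv m
  have hDc : ∀ m j, Torus.IsSmooth (fun y => Torus.partialDeriv m v y j) :=
    fun m j => (hD m).apply j
  have hBs : Torus.IsSmooth (fun x : T3 => ∑ i, ∑ j, ∑ k, Torus.partialDeriv j v x i *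
      Torus.partialDeriv k v x j * Torus.partialDeriv i v x k) := by
    have h : ∀ i j k, Torus.IsSmooth (fun x => Torus.partialDeriv j v x i *
        Torus.partialDeriv k v x j * Torus.partialDeriv i v x k) :=
      fun i j k => ((hDc j i).mul (hDc k j)).mul (hDc i k)
    simp only [Torus.IsSmooth, Torus.lift, Function.comp_def] at h ⊢
    exact ContDiff.sum fun i _ => ContDiff.sum fun j _ => ContDiff.sum fun k _ => h i j k
  have hCs : Torus.IsSmooth (fun x : T3 => ∑ m, ∑ i, Torus.partialDeriv m v x i *
      ⟪Torus.partialDeriv m v x, Torus.partialDeriv i v x⟫) := by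
    have h : ∀ m i, Torus.IsSmooth (fun x => Torus.partialDeriv m v x i *
        ⟪Torus.partialDeriv m v x, Torus.partialDeriv i v x⟫) :=
      fun m i => (hDc m i).mul ((hD m).inner (hD i))
    simp only [Torus.IsSmooth, Torus.lift, Function.comp_def] at h ⊢
    exact ContDiff.sum fun m _ => ContDiff.sum fun i _ => h m i
  set B : T3 → ℝ := fun x => ∑ i, ∑ j, ∑ k, Torus.partialDeriv j v x i *
    Torus.partialDeriv k v x j * Torus.partialDeriv i v x k with hB_def
  set C : T3 → ℝ := fun x => ∑ m, ∑ i, Torus.partialDeriv m v x i *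
    ⟪Torus.partialDeriv m v x, Torus.partialDeriv i v x⟫ with hC_def
  have horth : ∫ x, ⟪Torus.laplacian v x, Torus.convect v v x⟫ = -∫ x, C x :=
    Torus.integral_inner_laplacian_convect_self_eq_neg hv hdiv
  have hBet : ∫ x, B x = 0 := integral_sum_partialDeriv_cube_eq_zero hv hdiv
  have hdiff : -∫ x, C x = ∫ x, (B x - C x) := by
    rw [integral_sub hBs.integrable hCs.integrable, hBet, zero_sub]
  have hpt : ∀ x, B x - C x ≤ M * ∑ m, ‖Torus.partialDeriv m v x‖ ^ 2 := fun x =>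
    sum_partialDeriv_cube_sub_stretch_le hd hv hdiv hM x (hω x)
  have hGs : Integrable (fun x => M * ∑ m, ‖Torus.partialDeriv m v x‖ ^ 2) :=
    (Torus.isSmooth_sum_norm_sq_partialDeriv hv).integrable.const_mul M
  have hmono : ∫ x, (B x - C x) ≤ ∫ x, M * ∑ m, ‖Torus.partialDeriv m v x‖ ^ 2 :=
    integral_mono (hBs.integrable.sub hCs.integrable) hGs hpt
  have hgrad : ∫ x, M * ∑ m, ‖Torus.partialDeriv m v x‖ ^ 2 = M * Torus.gradNormSq v := by
    rw [integral_const_mul, ← Torus.gradNormSq]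
  calc ∫ x, ⟪Torus.laplacian v x, Torus.convect v v x⟫ = ∫ x, (B x - C x) := by rw [horth, hdiff]
    _ ≤ ∫ x, M * ∑ m, ‖Torus.partialDeriv m v x‖ ^ 2 := hmono
    _ = M * Torus.gradNormSq v := hgrad

/-- **The sign of the enstrophy rate above the absorbing ball** (p. 25 l. 70–90: «dΩ/dt ≤
c₁Ω^{3/2} − νc₂Ω² … is < 0 as soon as Ω > Ω*»): for a smooth divergence-free field `v` on `𝕋³`
with `E(v) ≤ E₀`, `|ω(x)|² ≤ C₁²‖∇v‖₂²` and `‖∇v‖₂² ≥ Ω* = (2E₀|C₁|/ν)²`, the `H¹`-balance rate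
`−ν‖Δv‖₂² + ∫⟪(v·∇)v, Δv⟫` is `≤ 0`. [cite: Siche2026, Thm 7.3 proof p. 25] -/
theorem enstrophyRate_nonpos {ν : ℝ} (hν : 0 < ν) {E₀ C₁ : ℝ} {v : T3 → E3}
    (hv : Torus.IsSmooth v) (hdiv : Torus.IsDivFree v) (hE : Torus.kineticEnergy v ≤ E₀)
    (hω : ∀ x, torusVorticitySqAt v x ≤ C₁ ^ 2 * Torus.gradNormSq v)
    (hΩ : (2 * E₀ * |C₁| / ν) ^ 2 ≤ Torus.gradNormSq v) :
    -ν * (∫ x, ‖Torus.laplacian v x‖ ^ 2) + ∫ x, ⟪Torus.convect v v x, Torus.laplacian v x⟫ ≤ 0 := by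
  set Ω := Torus.gradNormSq v with hΩdef
  set D := ∫ x, ‖Torus.laplacian v x‖ ^ 2 with hDdef
  have hΩ0 : 0 ≤ Ω := Torus.gradNormSq_nonneg v
  have hD0 : 0 ≤ D := integral_nonneg fun x => sq_nonneg _
  -- the stretching term
  set M := |C₁| * Real.sqrt Ω with hMdef
  have hM0 : 0 ≤ M := mul_nonneg (abs_nonneg _) (Real.sqrt_nonneg _)
  have hωM : ∀ x, torusVorticitySqAt v x ≤ M ^ 2 := fun x => by
    rw [hMdef, mul_pow, sq_abs, Real.sq_sqrt hΩ0]; exact hω x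
  have hX : ∫ x, ⟪Torus.convect v v x, Torus.laplacian v x⟫ ≤ M * Ω := by
    have hc : ∫ x, ⟪Torus.convect v v x, Torus.laplacian v x⟫ =
        ∫ x, ⟪Torus.laplacian v x, Torus.convect v v x⟫ :=
      integral_congr_ae (ae_of_all _ fun x => real_inner_comm _ _)
    rw [hc]
    exact integral_inner_laplacian_convect_le hv hdiv hM0 hωM
  -- the interpolation `Ω² ≤ 2E₀ D`
  have hint : Ω ^ 2 ≤ 2 * E₀ * D := by
    have h1 := gradNormSq_sq_le_integral_mul_integral hv
    have h2 : ∫ y, ‖v y‖ ^ 2 = 2 * Torus.kineticEnergy v := by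
      rw [Torus.kineticEnergy]; ring
    rw [h2] at h1
    calc Ω ^ 2 ≤ 2 * Torus.kineticEnergy v * D := h1
      _ ≤ 2 * E₀ * D := by nlinarith
  -- `M Ω ≤ ν D`
  have hkey : M * Ω ≤ ν * D := by
    rcases hΩ0.eq_or_lt with hz | hpos
    · rw [← hz, mul_zero]; exact mul_nonneg hν.le hD0
    · -- `E₀ > 0`
      have hE0 : 0 < E₀ := by
        rcases le_or_gt E₀ 0 with hle | hpos'
        · exfalso
          have : Ω ^ 2 ≤ 0 := hint.trans (by nlinarith)
          nlinarith
        · exact hpos'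
      -- `√Ω ≥ 2 E₀ |C₁| / ν`
      have hs : 2 * E₀ * |C₁| / ν ≤ Real.sqrt Ω := by
        have h0 : 0 ≤ 2 * E₀ * |C₁| / ν := by positivity
        calc 2 * E₀ * |C₁| / ν = Real.sqrt ((2 * E₀ * |C₁| / ν) ^ 2) := (Real.sqrt_sq h0).symm
          _ ≤ Real.sqrt Ω := Real.sqrt_le_sqrt hΩ
      have hsq : Real.sqrt Ω * Real.sqrt Ω = Ω := Real.mul_self_sqrt hΩ0
      -- `M Ω = |C₁| √Ω Ω ≤ (ν Ω / (2E₀)) Ω = ν Ω² / (2 E₀) ≤ ν D`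
      have h3 : |C₁| * Real.sqrt Ω ≤ ν * Ω / (2 * E₀) := by
        have h4 : 2 * E₀ * |C₁| ≤ ν * Real.sqrt Ω := by
          have := mul_le_mul_of_nonneg_left hs hν.le
          rwa [mul_div_cancel₀ _ hν.ne'] at this
        rw [le_div_iff₀ (by positivity)]
        nlinarith [Real.sqrt_nonneg Ω]
      have h5 : ν * Ω / (2 * E₀) * Ω ≤ ν * D := by
        rw [div_mul_eq_mul_div, div_le_iff₀ (by positivity)]
        nlinarith
      calc M * Ω = |C₁| * Real.sqrt Ω * Ω := by rw [hMdef]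
        _ ≤ ν * Ω / (2 * E₀) * Ω := mul_le_mul_of_nonneg_right h3 hΩ0
        _ ≤ ν * D := h5
  linarith

/-- **Step 7 holds** (Theorem 7.3 (62)–(64) p. 25, «Proof of Theorem 1.2, Step 3: the enstrophy
remains bounded», as typed): along a classical solution on `[0, T) × 𝕋³` with `E(t) ≤ E₀` and
the pointwise vorticity bound `|ω(t,x)|² ≤ C₁²‖∇u(t)‖₂²` on `(0, T)`, the enstrophy never exceeds
`max(‖∇u(0)‖₂², Ω*)`, `Ω* = (2E₀|C₁|/ν)²` — the set `{Ω ≤ max(Ω(0), Ω*)}` is forward invariant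
because the `H¹`-balance rate is `≤ 0` wherever `Ω ≥ Ω*` (`enstrophyRate_nonpos`; last-exit time
+ `antitoneOn_of_deriv_nonpos`). [cite: Siche2026, Thm 7.3 (62)–(64) p. 25] -/
theorem step7_holds : Step7_enstrophyClosure := by
  intro ν hν
  refine ⟨fun E₀ C₁ => (2 * E₀ * |C₁| / ν) ^ 2, ?_⟩
  intro E₀ C₁ T U P hsol hE hω t ht
  set B := max (Torus.gradNormSq (U 0)) ((2 * E₀ * |C₁| / ν) ^ 2) with hBdef
  rcases ht.1.eq_or_lt with h0 | h0t
  · rw [← h0]; exact le_max_left _ _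
  -- restrict the solution to the compact interval `[0, t]`
  have hsub : Icc 0 t ⊆ Ico 0 T := fun s hs => ⟨hs.1, hs.2.trans_lt ht.2⟩
  have hsol' : Torus.IsClassicalNSSolutionOn (Icc 0 t) ν 0 U P :=
    hsol.mono hsub (uniqueDiffOn_Icc h0t)
  -- the `H¹` balance on `[0, t]`
  set g : ℝ → ℝ := fun s => 2⁻¹ * Torus.gradNormSq (U s) with hgdef
  set R : ℝ → ℝ := fun s => -ν * (∫ x, ‖Torus.laplacian (U s) x‖ ^ 2) +
    ∫ x, ⟪Torus.convect (U s) (U s) x - (0 : ℝ → T3 → E3) s x, Torus.laplacian (U s) x⟫ with hRdef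
  have hderiv : ∀ s ∈ Icc 0 t, HasDerivWithinAt g (R s) (Icc 0 t) s := fun s hs =>
    hsol'.hasDerivWithinAt_half_gradNormSq h0t hs
  have hgc : ContinuousOn g (Icc 0 t) := fun s hs => (hderiv s hs).continuousWithinAt
  have hΩc : ContinuousOn (fun s => Torus.gradNormSq (U s)) (Icc 0 t) := by
    have e : (fun s => Torus.gradNormSq (U s)) = fun s => 2 * g s := by
      funext s; simp only [hgdef]; ring
    rw [e]; exact continuousOn_const.mul hgc
  -- the rate is `≤ 0` wherever `Ω ≥ Ω*`, at interior times
  have hrate : ∀ r ∈ Ioo 0 t, (2 * E₀ * |C₁| / ν) ^ 2 ≤ Torus.gradNormSq (U r) → R r ≤ 0 := by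
    intro r hr hΩr
    have hrT : r ∈ Ico 0 T := ⟨hr.1.le, hr.2.trans ht.2⟩
    have hrt : r ∈ Icc 0 t := ⟨hr.1.le, hr.2.le⟩
    have hur : Torus.IsSmooth (U r) := hsol'.smooth_velocity.isSmooth_slice hrt
    have hdivr : Torus.IsDivFree (U r) := hsol'.divFree r hrt
    have h := enstrophyRate_nonpos hν hur hdivr (hE r hrT) (hω r ⟨hr.1, hr.2.trans ht.2⟩) hΩr
    have e : R r = -ν * (∫ x, ‖Torus.laplacian (U r) x‖ ^ 2) +
        ∫ x, ⟪Torus.convect (U r) (U r) x, Torus.laplacian (U r) x⟫ := by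
      simp only [hRdef, Pi.zero_apply, sub_zero]
    rw [e]; exact h
  -- barrier argument: last exit time from `{Ω ≤ B}`
  rcases le_or_gt (Torus.gradNormSq (U t)) B with hle | hgt
  · exact hle
  exfalso
  set S : Set ℝ := Icc 0 t ∩ (fun s => Torus.gradNormSq (U s)) ⁻¹' Iic B with hSdef
  have hS0 : (0 : ℝ) ∈ S := by
    refine ⟨⟨le_rfl, h0t.le⟩, ?_⟩
    show Torus.gradNormSq (U 0) ≤ B
    exact le_max_left _ _
  have hSbdd : BddAbove S := ⟨t, fun s hs => hs.1.2⟩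
  have hSclosed : IsClosed S := hΩc.preimage_isClosed_of_isClosed isClosed_Icc isClosed_Iic
  set s₀ := sSup S with hs₀def
  have hs₀S : s₀ ∈ S := hSclosed.csSup_mem ⟨0, hS0⟩ hSbdd
  have hs₀le : Torus.gradNormSq (U s₀) ≤ B := hs₀S.2
  have hs₀t : s₀ < t :=
    lt_of_le_of_ne hs₀S.1.2 (fun h => by rw [h] at hs₀le; exact (not_le.mpr hgt) hs₀le)
  have hs₀0 : 0 ≤ s₀ := hs₀S.1.1
  have habove : ∀ r ∈ Ioo s₀ t, B < Torus.gradNormSq (U r) := by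
    intro r hr
    rcases lt_or_ge B (Torus.gradNormSq (U r)) with h | hle
    · exact h
    · exfalso
      have hrS : r ∈ S := ⟨⟨hs₀0.trans hr.1.le, hr.2.le⟩, hle⟩
      exact (not_le.mpr hr.1) (le_csSup hSbdd hrS)
  -- `g` is antitone on `[s₀, t]`
  have hanti : AntitoneOn g (Icc s₀ t) := by
    have hsubI : Icc s₀ t ⊆ Icc 0 t := Icc_subset_Icc hs₀0 le_rfl
    refine antitoneOn_of_deriv_nonpos (convex_Icc s₀ t) (hgc.mono hsubI) ?_ ?_
    · rw [interior_Icc]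
      intro r hr
      have hr0t : r ∈ Ioo 0 t := ⟨hs₀0.trans_lt hr.1, hr.2⟩
      exact ((hderiv r ⟨hr0t.1.le, hr0t.2.le⟩).hasDerivAt
        (Icc_mem_nhds hr0t.1 hr0t.2)).differentiableAt.differentiableWithinAt
    · rw [interior_Icc]
      intro r hr
      have hr0t : r ∈ Ioo 0 t := ⟨hs₀0.trans_lt hr.1, hr.2⟩
      have hd : HasDerivAt g (R r) r :=
        (hderiv r ⟨hr0t.1.le, hr0t.2.le⟩).hasDerivAt (Icc_mem_nhds hr0t.1 hr0t.2)
      rw [hd.deriv]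
      exact hrate r hr0t ((le_max_right _ _).trans (habove r hr).le)
  have hgt' : g t ≤ g s₀ :=
    hanti (left_mem_Icc.2 hs₀t.le) (right_mem_Icc.2 hs₀t.le) hs₀t.le
  have : Torus.gradNormSq (U t) ≤ Torus.gradNormSq (U s₀) := by
    simp only [hgdef] at hgt'; linarith
  exact (not_le.mpr hgt) (this.trans hs₀le)

end Literature.Claims.NS.Siche2026
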